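import Literature.AlgebraicGeometry.Milne1999.SpecialLefschetzGroupInvariantsCommutativeEnd
import HarnessLib

/-!
# Milne 1999, §1–§2: `C(A) ⊗ ℂ` is the commutant of ONE pull-back `φ^*` iff `End(A)` is commutative — and Theorem 3.2 / Corollary 4.5 under that single hypothesis

Family `hodge`, layer `Literature/AlgebraicGeometry/Milne1999`, namespace
`Literature.AlgebraicGeometry.Milne1999` (D-0022). THEOREMS ONLY (no definition, no named fact; D-0026).
Written for the cell `pub-hodgecm2` (COR-CM), seat `lit-milne`, binder table `HOME/lit/milne.md` rows
M2/M4; closes the single-generator line `Milne1999/SpecialLefschetzGroupInvariantsSymplectic`,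
`…ImaginaryQuadratic`, `…RealMultiplication`, `…SingleGenerator`, `Milne1999/LefschetzCentraliserRosatiInvolution`
(§2–§3) and `Milne1999/SpecialLefschetzGroupInvariantsCommutativeEnd`.

[Milne1999LefschetzClasses] §1 p. 642: «we define `C(A)` to be the centralizer of `End⁰(A)` in
`End_k(V(A))`: `C(A) = End_{End⁰(A) ⊗_ℚ k}(V(A))`», and §2 (pp. 645–650): for a simple `A` of type I
(`E = End⁰(A) = F` a totally real field) resp. of type IV with `d = 1` (`E = K` a CM field) —
equivalently for commutative `E` — `E ⊗ k^{al} = ∏_σ k^{al}` and `C(A) ⊗ k^{al} = ∏_σ End(V_σ)`: the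
commutant of any element of `E` separating the `V_σ`.  On the tree's carriers (`C(A) ⊗ ℂ =
centralizerAlgebra A` on `H¹(A(ℂ); ℂ)`, `Milne1999/LefschetzCentraliser`) this file PROVES the
characterisation

* **`exists_centralizerAlgebra_eq_centralizer_singleton_iff_forall_comp_comm`** —
  `(∃ φ ∈ End(A), C(A) ⊗ ℂ = commutant of φ^*) ↔ End(A) commutative`.
  `⇐` is the generator of `exists_forall_pullbackOne_mem_adjoin_of_forall_comp_comm`
  (`Milne1999/SpecialLefschetzGroupInvariantsCommutativeEnd`); `⇒`
  (`forall_comp_comm_of_centralizerAlgebra_eq_centralizer_singleton`): every `ψ^*` commutes with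
  `C(A) ⊗ ℂ` (Remark 1.2, tautologically: `pullbackOne_mem_centralizer_centralizerAlgebra`), in particular
  with `φ^* ∈ C(A) ⊗ ℂ`; so `ψ^* ∈` commutant of `φ^*` `= C(A) ⊗ ℂ` commutes with every pull-back, and
  the representation of `End(A)` on `H¹(A(ℂ); ℂ)` is faithful
  (`ComplexMultiplication.hom_eq_zero_of_complexBetti_map_one_eq_zero`).

and hence the conclusion of the cited record `Milne1999_specialLefschetzGroup_invariants_le`
(`Milne1999/LefschetzGroup`; Milne 1999 Cor. 4.5 with Thm. 4.4 and Thm. 3.2) under the SINGLE hypothesis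
`centralizerAlgebra A = Subalgebra.centralizer ℂ {φ^*}` for some `φ ∈ End(A)` — the diagonalisability
hypothesis `hdiag` of `specialLefschetzGroup_invariants_le_of_generator` is redundant
(`iSup_eigenspace_pullbackOne_eq_top_of_centralizerAlgebra_eq_centralizer_singleton`):
**`specialLefschetzGroup_invariants_le_of_centralizerAlgebra_eq_centralizer_singleton`**, with the set
form of Cor. 4.5, Prop. 4.8 (c) ⇒ (a), and the `S(A)(ℂ)`-invariant form for a given polarization class.
With this, every hypothesis of the single-generator files beyond `hC` (`hdiag`, the polarization class
`h`, the adjoint datum `J'` / `hJQ`) is discharged, and all of them are the case «`End(A)` commutative».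

## References

* [Milne1999LefschetzClasses] J. S. Milne, Lefschetz classes on abelian varieties, Duke Math. J. 96
  (1999) 639–675: §1 pp. 642–643 (`C(A)`, Remark 1.2), §2 pp. 645–650, Thm. 3.2, Cor. 4.5 (p. 659),
  Prop. 4.8 (p. 660).
* [LangeBirkenhake1992] H. Lange, Ch. Birkenhake, Complex Abelian Varieties (1992), §1.2 (the rational
  and analytic representations are faithful), Thm. 5.5.6.
-/

noncomputable section

open CategoryTheory
open Literature.AlgebraicTopology.SingularHomology
open Literature.AlgebraicGeometry.HodgeTheory
open Literature.AlgebraicGeometry.Motives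
open Literature.AlgebraicGeometry.VanGeemen1994 (pullbackOne hodgeClassSpan)
open Literature.Barriers.HodgeConjecture (divisorClassesSpan)

namespace Literature.AlgebraicGeometry.Milne1999

variable {A : AbelianVariety ℂ}

/-- `(φ ≫ ψ)^* = φ^* ∘ ψ^*` on `H¹`, in `Module.End`. [folklore] -/
private theorem pullbackOne_comp' (φ ψ : A ⟶ A) : pullbackOne A (φ ≫ ψ) = pullbackOne A φ * pullbackOne A ψ := by
  change (complexBetti.map (φ.hom.hom.hom ≫ ψ.hom.hom.hom) 1).hom = _
  rw [complexBetti.map_comp, ModuleCat.hom_comp]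
  rfl

/-- **If `C(A) ⊗ ℂ` is the commutant of one `φ^*`, every pull-back `ψ^*` lies in `C(A) ⊗ ℂ`** (i.e. the
`ψ^*` commute pairwise): `ψ^*` commutes with `C(A) ⊗ ℂ` (Remark 1.2), in particular with
`φ^* ∈ C(A) ⊗ ℂ = ` commutant of `φ^*`. [cite: Milne1999LefschetzClasses, §1 p. 642 and Remark 1.2 (p. 643)] -/
theorem pullbackOne_mem_centralizerAlgebra_of_centralizerAlgebra_eq_centralizer_singleton (φ : A ⟶ A)
    (hC : centralizerAlgebra A = Subalgebra.centralizer ℂ {pullbackOne A φ}) (ψ : A ⟶ A) :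
    pullbackOne A ψ ∈ centralizerAlgebra A := by
  have hφ : pullbackOne A φ ∈ centralizerAlgebra A := by
    rw [hC, Subalgebra.mem_centralizer_iff]
    intro g hg
    rw [Set.mem_singleton_iff.1 hg]
  rw [hC, Subalgebra.mem_centralizer_iff]
  intro g hg
  rw [Set.mem_singleton_iff.1 hg]
  exact (Subalgebra.mem_centralizer_iff ℂ).1 (pullbackOne_mem_centralizer_centralizerAlgebra ψ) _ hφ

/-- **If `C(A) ⊗ ℂ` is the commutant of one `φ^*`, then `End(A)` is commutative** (the pull-backs
commute pairwise, and `End(A) → End(H¹(A(ℂ); ℂ))` is faithful, Lange–Birkenhake §1.2).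
[cite: Milne1999LefschetzClasses, §1 p. 642 and §2 pp. 645–650] [cite: LangeBirkenhake1992, §1.2] -/
theorem forall_comp_comm_of_centralizerAlgebra_eq_centralizer_singleton (φ : A ⟶ A)
    (hC : centralizerAlgebra A = Subalgebra.centralizer ℂ {pullbackOne A φ}) :
    ∀ ψ₁ ψ₂ : A ⟶ A, ψ₁ ≫ ψ₂ = ψ₂ ≫ ψ₁ := by
  intro ψ₁ ψ₂
  have h : pullbackOne A (ψ₁ ≫ ψ₂) = pullbackOne A (ψ₂ ≫ ψ₁) := by
    rw [pullbackOne_comp', pullbackOne_comp']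
    exact mem_centralizerAlgebra_iff.1
      (pullbackOne_mem_centralizerAlgebra_of_centralizerAlgebra_eq_centralizer_singleton φ hC ψ₂) ψ₁
  have e0 : (complexBetti.map (ψ₁ ≫ ψ₂ - ψ₂ ≫ ψ₁).hom.hom.hom 1).hom = 0 := by
    rw [complexBetti_map_sub_one, ModuleCat.hom_sub]
    exact sub_eq_zero.2 h
  exact sub_eq_zero.1 (ComplexMultiplication.hom_eq_zero_of_complexBetti_map_one_eq_zero _ e0)

/-- **Milne §1–§2 on the carriers: `C(A) ⊗ ℂ` is the commutant of ONE pull-back `φ^*`, `φ ∈ End(A)`,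
iff `End(A)` is commutative** (for commutative `E = End⁰(A)`: `C(A) ⊗ k^{al} = ∏_σ End(V_σ)` is the
commutant of any element of `E` separating the eigenspaces `V_σ`; `⇐` is
`exists_forall_pullbackOne_mem_adjoin_of_forall_comp_comm`).
[cite: Milne1999LefschetzClasses, §1 p. 642 and §2 pp. 645–650] -/
theorem exists_centralizerAlgebra_eq_centralizer_singleton_iff_forall_comp_comm :
    (∃ φ : A ⟶ A, centralizerAlgebra A = Subalgebra.centralizer ℂ {pullbackOne A φ}) ↔
      ∀ φ ψ : A ⟶ A, φ ≫ ψ = ψ ≫ φ := by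
  refine ⟨fun ⟨φ, hC⟩ => forall_comp_comm_of_centralizerAlgebra_eq_centralizer_singleton φ hC, fun hcomm => ?_⟩
  obtain ⟨φ, hgen⟩ := exists_forall_pullbackOne_mem_adjoin_of_forall_comp_comm hcomm
  exact ⟨φ, centralizerAlgebra_eq_centralizer_singleton_of_forall_mem_adjoin φ hgen⟩

/-- The same with the hypothesis read in `End⁰(A) = ℚ ⊗ End(A)`. [cite: Milne1999LefschetzClasses, §1 p. 642 and §2 pp. 645–650] -/
theorem exists_centralizerAlgebra_eq_centralizer_singleton_iff_endAlgebra_comm :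
    (∃ φ : A ⟶ A, centralizerAlgebra A = Subalgebra.centralizer ℂ {pullbackOne A φ}) ↔
      ∀ x y : A.endAlgebra, x * y = y * x :=
  exists_centralizerAlgebra_eq_centralizer_singleton_iff_forall_comp_comm.trans forall_comp_comm_iff_endAlgebra_comm

/-- **A generator of `C(A) ⊗ ℂ`'s commutant is automatically diagonalisable on `H¹(A(ℂ); ℂ)`**
(`End(A)` is then commutative, and every pull-back of a commutative `End(A)` is semisimple,
`iSup_eigenspace_pullbackOne_eq_top_of_forall_comp_comm`). [cite: Milne1999LefschetzClasses, §2 pp. 646–650] -/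
theorem iSup_eigenspace_pullbackOne_eq_top_of_centralizerAlgebra_eq_centralizer_singleton (φ : A ⟶ A)
    (hC : centralizerAlgebra A = Subalgebra.centralizer ℂ {pullbackOne A φ}) (ψ : A ⟶ A) :
    ⨆ μ : ℂ, Module.End.eigenspace (pullbackOne A ψ) μ = ⊤ :=
  iSup_eigenspace_pullbackOne_eq_top_of_forall_comp_comm
    (forall_comp_comm_of_centralizerAlgebra_eq_centralizer_singleton φ hC) ψ

/-- **The conclusion of the record `Milne1999_specialLefschetzGroup_invariants_le` (Milne 1999, Cor. 4.5
with Thm. 4.4 and Thm. 3.2) under the single hypothesis «`C(A) ⊗ ℂ` is the commutant of one `φ^*`»**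
(`specialLefschetzGroup_invariants_le_of_generator` with its diagonalisability hypothesis discharged):
every class of `H^{2p}(A(ℂ); ℂ)` fixed by `specialLefschetzGroup (dim A) A.X` lies in
`Dᵖ_hom(A)_ℂ = divisorClassesSpan A.X (dim A) p`.
[cite: Milne1999LefschetzClasses, §2 pp. 645–650, Thm. 3.2, Cor. 4.5 (p. 659)] -/
theorem specialLefschetzGroup_invariants_le_of_centralizerAlgebra_eq_centralizer_singleton (φ : A ⟶ A)
    (hC : centralizerAlgebra A = Subalgebra.centralizer ℂ {pullbackOne A φ})
    (p : ℕ) (x : complexBetti A.X (2 * p)) (hx : ∀ g ∈ specialLefschetzGroup A.dim A.X, g (2 * p) x = x) :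
    x ∈ divisorClassesSpan A.X A.dim p :=
  specialLefschetzGroup_invariants_le_of_forall_comp_comm
    (forall_comp_comm_of_centralizerAlgebra_eq_centralizer_singleton φ hC) p x hx

/-- **Cor. 4.5 as an equality of sets**, same hypothesis. [cite: Milne1999LefschetzClasses, Cor. 4.5 (p. 659)] -/
theorem setOf_forall_apply_eq_self_eq_divisorClassesSpan_of_centralizerAlgebra_eq_centralizer_singleton
    (φ : A ⟶ A) (hC : centralizerAlgebra A = Subalgebra.centralizer ℂ {pullbackOne A φ}) (p : ℕ) :
    {x : complexBetti A.X (2 * p) | ∀ g ∈ specialLefschetzGroup A.dim A.X, g (2 * p) x = x} =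
      (divisorClassesSpan A.X A.dim p : Set _) :=
  setOf_forall_apply_eq_self_eq_divisorClassesSpan_of_forall_comp_comm
    (forall_comp_comm_of_centralizerAlgebra_eq_centralizer_singleton φ hC) p

/-- **Milne Prop. 4.8, (c) ⇒ (a) on `A`**, same hypothesis. [cite: Milne1999LefschetzClasses, Prop. 4.8 and Cor. 4.5 (pp. 659–660)] -/
theorem isDivisorGenerated_of_hodgeGroup_eq_specialLefschetzGroup_of_centralizerAlgebra_eq_centralizer_singleton
    (φ : A ⟶ A) (hC : centralizerAlgebra A = Subalgebra.centralizer ℂ {pullbackOne A φ})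
    (hHg : hodgeGroup A.dim A.X = specialLefschetzGroup A.dim A.X) : IsDivisorGenerated A :=
  isDivisorGenerated_of_hodgeGroup_eq_specialLefschetzGroup_of_forall_comp_comm
    (forall_comp_comm_of_centralizerAlgebra_eq_centralizer_singleton φ hC) hHg

/-- **The `S(A)(ℂ)`-invariant form for a given polarization class**, same hypothesis: for `h` rational
with a Kähler multiple `s · h` (`s > 0`), every class of `H^{2p}(A(ℂ); ℂ)` fixed by `⋀^{2p}u` for all
`u ∈ S(A)(ℂ) = unitaryCentralizerGroup A h` lies in `Dᵖ(A) ⊗ ℂ`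
(`mem_divisorClassesSpan_of_forall_exteriorPullback_eq_of_generator` without `hdiag`).
[cite: Milne1999LefschetzClasses, §1 p. 644, Thm. 3.2, Prop. 3.6 (a), (c), p. 656] -/
theorem mem_divisorClassesSpan_of_forall_exteriorPullback_eq_of_centralizerAlgebra_eq_centralizer_singleton
    (φ : A ⟶ A) (hC : centralizerAlgebra A = Subalgebra.centralizer ℂ {pullbackOne A φ})
    {h : complexBetti A.X 2} (hQ : IsRationalClass h)
    (hK : ∃ s : ℝ, 0 < s ∧ IsKaehlerClass A.dim A.X ((s : ℂ) • h))
    (p : ℕ) (x : complexBetti A.X (2 * p))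
    (hx : ∀ u ∈ unitaryCentralizerGroup A h,
      exteriorPullback (AbelianVariety.hasExteriorCohomologyH1_complexPoints A)
        (u : complexBetti A.X 1 →ₗ[ℂ] complexBetti A.X 1) (2 * p) x = x) :
    x ∈ divisorClassesSpan A.X A.dim p :=
  mem_divisorClassesSpan_of_forall_exteriorPullback_eq_of_generator φ hC
    (iSup_eigenspace_pullbackOne_eq_top_of_centralizerAlgebra_eq_centralizer_singleton φ hC φ) hQ hK p x hx

end Literature.AlgebraicGeometry.Milne1999

end
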